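import Literature.Topology.FourManifolds.MappingTorus
import Literature.Topology.FourManifolds.CerfGammaFourProofs
import HarnessLib

/-!
# `T_φ ≅ T_{φ⁻¹}`: a smooth mapping torus of `φ` is one of `φ⁻¹` (proofs)

Sibling proofs file of `MappingTorus.lean`: discharge of the named fact
`Literature.Topology.FourManifolds.isMappingTorusOf_symm_iff` (D-0014: `def X : Prop` facts are discharged as
`theorem X_holds : X`):

* `Literature.isMappingTorusOf_symm_iff_holds : isMappingTorusOf_symm_iff` — a manifold `T` is a smooth
  mapping torus (`Literature.IsMappingTorusOf IT T ·`, an open gluing of the cylinders `A = M × (0, 1)` and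
  `B = M × (1/2, 3/2)` along `Literature.Topology.FourManifolds.mappingTorusRel`) of the diffeomorphism `φ.symm` iff it is one
  of `φ`; dot-notation form `Literature.Topology.FourManifolds.IsMappingTorusOf.symm`, unbundled iff
  `Literature.Topology.FourManifolds.isMappingTorusOf_symm_iff'`.

Source. Hatcher, *Algebraic Topology* (2002), Ch. 1 §1.2 Exercise 11 (p. 53) and Ch. 2
Example 2.48 (p. 151) define the mapping torus of `f : X → X` as the quotient of `X × I` by
`(x, 0) ∼ (f x, 1)`. The printed source contains the definition only; that the mapping tori of a
homeomorphism and of its inverse agree is the routine consequence recorded in the docstring of the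
fact (reflect the interval: `(x, t) ↦ (x, 1 - t)` carries `(x, 0) ∼ (φ x, 1)` to
`(y, 0) ∼ (φ⁻¹ y, 1)`), and we formalise exactly that argument for the two-cylinder presentation.

Proof. Let `jA : A → T`, `jB : B → T` be a gluing for `φ` (`jA a = jB b ↔ mappingTorusRel φ a b`).
Precompose with the self-diffeomorphisms `ψA (x, s) = (x, 1 - s)` of `A`
(`Literature.Topology.FourManifolds.exists_mappingTorusPieceOne_flip`) and `ψB (y, t) = (φ y, 2 - t)` of `B`
(`Literature.Topology.FourManifolds.exists_mappingTorusPieceTwo_flip`): the ranges are unchanged, and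
`jA (ψA (x, s)) = jB (ψB (y, t)) ↔ (2 - t = 1 - s ∧ φ y = x) ∨ (2 - t = 2 - s ∧ φ y = φ x)
  ↔ (t = s + 1 ∧ y = φ⁻¹ x) ∨ (t = s ∧ y = x) ↔ mappingTorusRel φ.symm (x, s) (y, t)`
(`Literature.Topology.FourManifolds.mappingTorusRel_flip`). The maps `jA ∘ ψA`, `jB ∘ ψB` are again `C^∞` embeddings by
`Manifold.IsSmoothEmbedding.comp_diffeomorph` (file `CerfGammaFourProofs`, filling Mathlib's
`proof_wanted IsSmoothEmbedding.comp` in the case needed), which requires the cylinders to be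
`C^∞` manifolds (`IsManifold`): the fact carries **no** `IsManifold I ∞ M` hypothesis, but none is
needed, because a charted space admitting a Mathlib immersion into anything is automatically a
`C^n` manifold (`Literature.Topology.FourManifolds.isManifold_of_isImmersion`: every point lies in the source of a chart of the
maximal `C^n` atlas — the domain chart of the immersion — and any two atlas charts are then
`C^n`-compatible near every common point, by locality of the `C^n` groupoid;
`Literature.Topology.FourManifolds.isManifold_of_forall_mem_maximalAtlas`). The converse implication is the same statement for
`φ.symm`, as `φ.symm.symm = φ`.

## References
* A. Hatcher, *Algebraic Topology*, Cambridge University Press (2002), Ch. 1 §1.2 Ex. 11 (p. 53),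
  Ch. 2 Example 2.48 (p. 151). [cite: HatcherAT2002, Ch. 2 Example 2.48]
* S. E. Cappell, J. L. Shaneson, *Some new four-manifolds*, Ann. of Math. 104 (1976), §1
  (mapping tori `M × ℝ / (x, t) ∼ (φ x, t + 1)` of self-diffeomorphisms).
  [cite: CappellShaneson1976, §1]
-/

open scoped Manifold ContDiff Topology
open Set Function

noncomputable section

namespace Literature.Topology.FourManifolds

/-! ### A charted space admitting an immersion is a `C^n` manifold -/

section IsManifoldOfImmersion

variable {E H : Type*} [NormedAddCommGroup E] [NormedSpace ℝ E] [TopologicalSpace H]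
  {I : ModelWithCorners ℝ E H} {M : Type*} [TopologicalSpace M] [ChartedSpace H M] {n : ℕ∞ω}

open OpenPartialHomeomorph in
/-- **A charted space covered by charts of the maximal `C^n` atlas is a `C^n` manifold.** If every
point of a charted space `M` lies in the source of some chart `C^n`-compatible with the whole atlas
of `M`, then any two charts of the atlas are `C^n`-compatible (near `x`, factor the transition map
`c' ∘ c⁻¹` as `(c' ∘ e⁻¹) ∘ (e ∘ c⁻¹)` through such a chart `e` around `c⁻¹ x` and use locality of
the `C^n` groupoid), i.e. `IsManifold I n M`. This is the argument of Mathlib's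
`StructureGroupoid.compatible_of_mem_maximalAtlas` with the roles of the atlas and the maximal
atlas exchanged (Kosinski, *Differential Manifolds* (1993), I.(1.1): an atlas determines a unique
maximal atlas). [folklore] -/
theorem isManifold_of_forall_mem_maximalAtlas
    (h : ∀ x : M, ∃ e ∈ IsManifold.maximalAtlas I n M, x ∈ e.source) : IsManifold I n M := by
  have hG : HasGroupoid M (contDiffGroupoid n I) := by
    refine ⟨fun {c c'} hc hc' => ?_⟩
    set G := contDiffGroupoid n I
    refine G.locality fun x hx => ?_
    obtain ⟨f, hf, hxf⟩ := h (c.symm x)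
    let s := c.target ∩ c.symm ⁻¹' f.source
    have hs : IsOpen s := by
      apply c.symm.continuousOn_toFun.isOpen_inter_preimage <;> apply open_source
    have xs : x ∈ s := ⟨hx.1, hxf⟩
    refine ⟨s, hs, xs, ?_⟩
    have A : c.symm ≫ₕ f ∈ G := (hf c hc).2
    have B : f.symm ≫ₕ c' ∈ G := (hf c' hc').1
    have C : (c.symm ≫ₕ f) ≫ₕ f.symm ≫ₕ c' ∈ G := G.trans A B
    have D : (c.symm ≫ₕ f) ≫ₕ f.symm ≫ₕ c' ≈ (c.symm ≫ₕ c').restr s := calc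
      (c.symm ≫ₕ f) ≫ₕ f.symm ≫ₕ c' = c.symm ≫ₕ (f ≫ₕ f.symm) ≫ₕ c' := by simp only [trans_assoc]
      _ ≈ c.symm ≫ₕ ofSet f.source f.open_source ≫ₕ c' :=
        EqOnSource.trans' (Setoid.refl _) (EqOnSource.trans' (self_trans_symm _) (Setoid.refl _))
      _ ≈ (c.symm ≫ₕ ofSet f.source f.open_source) ≫ₕ c' := by rw [trans_assoc]
      _ ≈ c.symm.restr s ≫ₕ c' := by rw [trans_of_set']; apply Setoid.refl
      _ ≈ (c.symm ≫ₕ c').restr s := by rw [restr_trans]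
    exact G.mem_of_eqOnSource C (Setoid.symm D)
  exact IsManifold.mk' I n M

/-- **A charted space admitting an immersion is a `C^n` manifold.** If some map `f : M → N` is a
`C^n` immersion in Mathlib's sense (`Manifold.IsImmersion`: around every point there are charts
*of the maximal `C^n` atlases* in which `f` is a linear inclusion), then `M` is a `C^n` manifold:
the domain charts of the immersion cover `M` (`isManifold_of_forall_mem_maximalAtlas`). In
particular the pieces of an open gluing (`Literature.Topology.FourManifolds.IsOpenGluing`), which carries no `IsManifold`
hypothesis, are automatically `C^∞` manifolds. [folklore] -/
theorem isManifold_of_isImmersion {E' : Type*} [NormedAddCommGroup E'] [NormedSpace ℝ E']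
    {G : Type*} [TopologicalSpace G] {J : ModelWithCorners ℝ E' G}
    {N : Type*} [TopologicalSpace N] [ChartedSpace G N] {f : M → N}
    (hf : Manifold.IsImmersion I J n f) : IsManifold I n M :=
  isManifold_of_forall_mem_maximalAtlas fun x =>
    ⟨(hf.isImmersionAt x).domChart, (hf.isImmersionAt x).domChart_mem_maximalAtlas,
      (hf.isImmersionAt x).mem_domChart_source⟩

end IsManifoldOfImmersion

/-! ### Reflections of the cylinders -/

section Flip

/-- The point reflection `s ↦ c - s` of `ℝ` restricts to a self-diffeomorphism (an involution) of
any open subset `U ⊆ ℝ` invariant under it, for Mathlib's open-submanifold structure on `U`.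
(Stated as an existence theorem: this proofs file introduces no definitions.) [folklore] -/
theorem exists_diffeomorph_opens_coe_eq_const_sub (U : TopologicalSpace.Opens ℝ) (c : ℝ)
    (hU : ∀ s ∈ U, c - s ∈ U) :
    ∃ r : U ≃ₘ⟮𝓘(ℝ, ℝ), 𝓘(ℝ, ℝ)⟯ U, ∀ s : U, ((r s : U) : ℝ) = c - s := by
  have hr : ContMDiff 𝓘(ℝ, ℝ) 𝓘(ℝ, ℝ) ∞ fun s : U => (⟨c - s, hU s s.2⟩ : U) := by
    rw [← ContMDiff.subtypeVal_comp_iff]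
    exact (contDiff_const.sub contDiff_id).contMDiff.comp contMDiff_subtype_val
  exact ⟨{ toFun := fun s => ⟨c - s, hU s s.2⟩
           invFun := fun s => ⟨c - s, hU s s.2⟩
           left_inv := fun s => Subtype.ext (sub_sub_cancel c s)
           right_inv := fun s => Subtype.ext (sub_sub_cancel c s)
           contMDiff_toFun := hr
           contMDiff_invFun := hr }, fun _ => rfl⟩

variable {E H : Type*} [NormedAddCommGroup E] [NormedSpace ℝ E] [TopologicalSpace H]
  (I : ModelWithCorners ℝ E H) {M : Type*} [TopologicalSpace M] [ChartedSpace H M]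

/-- **Reflection of the first cylinder**: `A = M × (0, 1)` has a self-diffeomorphism
`ψA (x, s) = (x, 1 - s)` (product of the identity of `M` and the reflection of `(0, 1)` in `1/2`;
no `IsManifold` hypothesis on `M` is needed to write it down). [folklore] -/
theorem exists_mappingTorusPieceOne_flip :
    ∃ ψ : (M × mappingTorusPieceOne) ≃ₘ⟮I.prod 𝓘(ℝ, ℝ), I.prod 𝓘(ℝ, ℝ)⟯ M × mappingTorusPieceOne,
      ∀ a, (ψ a).1 = a.1 ∧ ((ψ a).2 : ℝ) = 1 - a.2 := by
  obtain ⟨r, hr⟩ := exists_diffeomorph_opens_coe_eq_const_sub mappingTorusPieceOne 1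
    fun s hs => by
      have hs' : 0 < s ∧ s < 1 := hs
      change 0 < 1 - s ∧ 1 - s < 1
      constructor <;> linarith [hs'.1, hs'.2]
  exact ⟨(Diffeomorph.refl I M ∞).prodCongr r, fun a => ⟨rfl, hr a.2⟩⟩

variable {I}

/-- **Reflection-with-twist of the second cylinder**: `B = M × (1/2, 3/2)` has a
self-diffeomorphism `ψB (y, t) = (φ y, 2 - t)` (product of `φ` and the reflection of `(1/2, 3/2)`
in `1`). [folklore] -/
theorem exists_mappingTorusPieceTwo_flip (φ : M ≃ₘ⟮I, I⟯ M) :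
    ∃ ψ : (M × mappingTorusPieceTwo) ≃ₘ⟮I.prod 𝓘(ℝ, ℝ), I.prod 𝓘(ℝ, ℝ)⟯ M × mappingTorusPieceTwo,
      ∀ b, (ψ b).1 = φ b.1 ∧ ((ψ b).2 : ℝ) = 2 - b.2 := by
  obtain ⟨r, hr⟩ := exists_diffeomorph_opens_coe_eq_const_sub mappingTorusPieceTwo 2
    fun t ht => by
      have ht' : 1 / 2 < t ∧ t < 3 / 2 := ht
      change 1 / 2 < 2 - t ∧ 2 - t < 3 / 2
      constructor <;> linarith [ht'.1, ht'.2]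
  exact ⟨φ.prodCongr r, fun b => ⟨rfl, hr b.2⟩⟩

/-- **The flips conjugate the gluing relation of `φ` into that of `φ⁻¹`.** For maps
`ψA (x, s) = (x, 1 - s)` of `A` and `ψB (y, t) = (φ y, 2 - t)` of `B`:
`mappingTorusRel φ (ψA (x, s)) (ψB (y, t))`, i.e.
`(2 - t = 1 - s ∧ φ y = x) ∨ (2 - t = (1 - s) + 1 ∧ φ y = φ x)`, is equivalent to
`(t = s ∧ y = x) ∨ (t = s + 1 ∧ y = φ⁻¹ x)`, i.e. to `mappingTorusRel φ.symm (x, s) (y, t)`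
(the computation in the docstring of `isMappingTorusOf_symm_iff`; Hatcher, *Algebraic Topology*,
Ch. 2 Example 2.48 for the identification `(x, 0) ∼ (φ x, 1)`). [folklore] -/
theorem mappingTorusRel_flip (φ : M ≃ₘ⟮I, I⟯ M)
    {ψA : M × mappingTorusPieceOne → M × mappingTorusPieceOne}
    {ψB : M × mappingTorusPieceTwo → M × mappingTorusPieceTwo}
    (hψA : ∀ a, (ψA a).1 = a.1 ∧ ((ψA a).2 : ℝ) = 1 - a.2)
    (hψB : ∀ b, (ψB b).1 = φ b.1 ∧ ((ψB b).2 : ℝ) = 2 - b.2)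
    (a : M × mappingTorusPieceOne) (b : M × mappingTorusPieceTwo) :
    mappingTorusRel φ (ψA a) (ψB b) ↔ mappingTorusRel φ.symm a b := by
  obtain ⟨hA1, hA2⟩ := hψA a
  obtain ⟨hB1, hB2⟩ := hψB b
  obtain ⟨x, s⟩ := a
  obtain ⟨y, t⟩ := b
  simp only [mappingTorusRel, hA1, hA2, hB1, hB2]
  rw [or_comm]
  refine or_congr ⟨?_, ?_⟩ ⟨?_, ?_⟩
  · rintro ⟨h1, h2⟩
    exact ⟨by linarith, φ.injective h2⟩
  · rintro ⟨h1, h2⟩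
    exact ⟨by rw [h1]; ring, by rw [h2]⟩
  · rintro ⟨h1, h2⟩
    exact ⟨by linarith, by rw [← h2, Diffeomorph.symm_apply_apply]⟩
  · rintro ⟨h1, h2⟩
    exact ⟨by rw [h1]; ring, by rw [h2, Diffeomorph.apply_symm_apply]⟩

end Flip

/-! ### The mapping tori of `φ` and `φ⁻¹` -/

section Symm

variable {E H : Type*} [NormedAddCommGroup E] [NormedSpace ℝ E] [TopologicalSpace H]
  {I : ModelWithCorners ℝ E H}
  {ET HT : Type*} [NormedAddCommGroup ET] [NormedSpace ℝ ET] [TopologicalSpace HT]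
  {IT : ModelWithCorners ℝ ET HT}
  {M : Type*} [TopologicalSpace M] [ChartedSpace H M]
  {T : Type*} [TopologicalSpace T] [ChartedSpace HT T]

/-- **A smooth mapping torus of `φ` is a smooth mapping torus of `φ⁻¹`.** Given a gluing
`jA : M × (0, 1) → T`, `jB : M × (1/2, 3/2) → T` realising `IsMappingTorusOf IT T φ`, the maps
`jA ∘ ψA`, `jB ∘ ψB` with `ψA (x, s) = (x, 1 - s)`, `ψB (y, t) = (φ y, 2 - t)`
(`exists_mappingTorusPieceOne_flip`, `exists_mappingTorusPieceTwo_flip`) realise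
`IsMappingTorusOf IT T φ.symm`:
same (open, covering) ranges, `C^∞` embeddings by `Manifold.IsSmoothEmbedding.comp_diffeomorph`
(the cylinders being `C^∞` manifolds by `isManifold_of_isImmersion`, no `IsManifold I ∞ M`
hypothesis needed), and gluing relation `mappingTorusRel φ.symm` by `mappingTorusRel_flip`.
(Hatcher, *Algebraic Topology* (2002), Ch. 2 Example 2.48 and Ch. 1 §1.2 Ex. 11 for the mapping
torus `(x, 0) ∼ (φ x, 1)`; the reflection argument is the one in the docstring of the named fact
`isMappingTorusOf_symm_iff`.) [cite: HatcherAT2002, Ch. 2 Example 2.48] -/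
theorem IsMappingTorusOf.symm {φ : M ≃ₘ⟮I, I⟯ M} (h : IsMappingTorusOf IT T φ) :
    IsMappingTorusOf IT T φ.symm := by
  obtain ⟨jA, jB, hA, hAo, hB, hBo, hU, hR⟩ := h
  haveI : IsManifold (I.prod 𝓘(ℝ, ℝ)) ∞ (M × mappingTorusPieceOne) :=
    isManifold_of_isImmersion hA.isImmersion
  haveI : IsManifold (I.prod 𝓘(ℝ, ℝ)) ∞ (M × mappingTorusPieceTwo) :=
    isManifold_of_isImmersion hB.isImmersion
  obtain ⟨ψA, hψA⟩ := exists_mappingTorusPieceOne_flip I (M := M)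
  obtain ⟨ψB, hψB⟩ := exists_mappingTorusPieceTwo_flip φ
  have hsA : Surjective ψA := EquivLike.surjective ψA
  have hsB : Surjective ψB := EquivLike.surjective ψB
  refine ⟨jA ∘ ψA, jB ∘ ψB, hA.comp_diffeomorph ψA, ?_, hB.comp_diffeomorph ψB, ?_, ?_,
    fun a b => ?_⟩
  · rwa [hsA.range_comp]
  · rwa [hsB.range_comp]
  · rwa [hsA.range_comp, hsB.range_comp]
  · rw [comp_apply, comp_apply, hR, mappingTorusRel_flip φ hψA hψB]

/-- **`T_φ ≅ T_{φ⁻¹}`, unbundled form of the named fact `isMappingTorusOf_symm_iff`.** A manifold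
`T` is a smooth mapping torus of `φ.symm` iff it is one of `φ` (`IsMappingTorusOf.symm` for `φ`
and for `φ.symm`, using `φ.symm.symm = φ`). Hence the direction convention of the monodromy in
`mappingTorusRel` does not affect which manifolds are mapping tori (Hatcher, *Algebraic Topology*
(2002), Ch. 2 Example 2.48; outline review #12). [cite: HatcherAT2002, Ch. 2 Example 2.48] -/
theorem isMappingTorusOf_symm_iff' (φ : M ≃ₘ⟮I, I⟯ M) :
    IsMappingTorusOf IT T φ.symm ↔ IsMappingTorusOf IT T φ := by
  refine ⟨fun h => ?_, fun h => h.symm⟩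
  have hφ : φ.symm.symm = φ := Diffeomorph.ext fun _ => rfl
  simpa only [hφ] using h.symm

/-- **Discharge of the named fact `isMappingTorusOf_symm_iff`** (`MappingTorus.lean`): a manifold
is a smooth mapping torus of `φ` iff it is one of `φ⁻¹` (Hatcher, *Algebraic Topology* (2002),
Ch. 2 Example 2.48: the mapping torus `(x, 0) ∼ (φ x, 1)`; reflecting the interval coordinate
exchanges `φ` and `φ⁻¹`). [cite: HatcherAT2002, Ch. 2 Example 2.48] -/
theorem isMappingTorusOf_symm_iff_holds :
    isMappingTorusOf_symm_iff (I := I) (IT := IT) (M := M) (T := T) :=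
  fun {φ} => isMappingTorusOf_symm_iff' φ

end Symm

end Literature.Topology.FourManifolds
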